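import Summits.Ventures.HodgeRepro2.SexticGalois

/-!
# Orientation / sign convention — the elementary facts behind TIER4 sub-claim B4

Blind cell `pub-hodge-repro2`, seat p1 (Tier 4, sub-claim B4 «orientation / sign convention»).

Two groups of statements, both used in route/T4-B4-p1.md:

1. **The archimedean normalisation** (Liu 2021, p. 6 ll. 6–7 «arg(z) := z/√(z z̄)», Remark 4.2
   «z ↦ arg(z)^{−w_τ}», p. 41 ll. 41–44 «μ^alg = μ |·|_E^{−1/2}»): for `z ≠ 0`,
   `arg(z)^{-1} = z̄/|z|` and `arg(z)^{-1} · |z|_E^{-1/2} = 1/z` where `|z|_E = z z̄ = |z|²` is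
   the normalised absolute value at a complex place; in the conjugate coordinate `w = z̄` the
   same function reads `w ↦ 1/w̄`.  This is the computation of TIER4 §B3(d.5) / T4B-route-3 R4 (ii)
   in which the component `1/z` of the «associated CM character» (Shimura 1998 (19.10a),
   Liu p. 140 ll. 34–37) is matched with the weight-one normalisation — the only place where the
   sign of the exponent (`−w_τ`, not `+w_τ`) enters the bridge.

2. **Complex conjugation exchanges the two parity tetrahedra, inversion fixes each.**  For a
   sextic Galois CM field with an injective CM type `τ : Fin 3 → Hom(K,ℂ)`, the parity
   tetrahedron `parityTetrahedron K τ` (cube vertices 111, 100, 010, 001) and its conjugate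
   `evenTetrahedron τ` (000, 011, 101, 110) are the two balanced faces without conjugate pairs
   (`Sextic.cube_classification`); conjugating every vertex maps one onto the other
   (`evenTetrahedron_eq_conjCMType`, `range_conjCMType_evenTetrahedron`), while the inverse-type
   relabelling `T ↦ T^{-1}` of TIER4 §B3(e) maps each onto itself
   (`range_inverseType_parityTetrahedron` (landed) and `range_inverseType_evenTetrahedron`
   here), for every base embedding `τ₀`.  Consequences for B4: (a) the inversion forced by the
   dictionary of §B3(d) only relabels the four factors of `B`; (b) the conjugate convention
   (`Φ_μ ↦ Φ̄_μ`, the switch `(μ, ε) ↦ (μ^c, −ε)` of Liu's remark after Def. 4.12, or `τ₁ ↦ τ̄₁`)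
   replaces the tetrahedron by the other one, which is the same abelian variety `B` with the
   `F`-action composed with complex conjugation (TIER4 §A11.3).
-/

namespace Summit.Ventures.HodgeRepro2

section Arg

open Complex

/-- Liu's argument character `arg(z) := z / √(z z̄)` (Liu 2021, p. 6 ll. 6–7), written with
`z z̄ = normSq z`. -/
noncomputable def liuArg (z : ℂ) : ℂ := z / ((Real.sqrt (Complex.normSq z) : ℝ) : ℂ)

/-- `|z|_E := z z̄`, the normalised absolute value of `z` at a complex place (Liu's `|·|_E` at
an archimedean place of the CM field `E`, `(E ⊗_{F,τ} ℝ)^× ≅ ℂ^×`). -/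
noncomputable def complexPlaceAbs (z : ℂ) : ℝ := Complex.normSq z

/-- `z z̄ = |z|²`, so `√(z z̄) = |z|` and `arg(z) = z/|z|`. -/
theorem liuArg_eq_div_norm (z : ℂ) : liuArg z = z / ((‖z‖ : ℝ) : ℂ) := by
  unfold liuArg
  rw [Complex.normSq_eq_norm_sq, Real.sqrt_sq (norm_nonneg z)]

/-- `arg(z) ≠ 0` for `z ≠ 0`. -/
theorem liuArg_ne_zero {z : ℂ} (hz : z ≠ 0) : liuArg z ≠ 0 := by
  rw [liuArg_eq_div_norm]
  exact div_ne_zero hz (by exact_mod_cast norm_ne_zero_iff.mpr hz)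

/-- `arg(z)^{-1} = z̄ / |z|` — the weight-one archimedean component of a conjugate
symplectic character in the coordinate of the embedding in its CM type (Liu Remark 4.2 with
`w_τ = 1`; Dimitrov–Ramakrishnan 2015 Lemma 3.5 «`λ_∞(z) = ∏_{v ∈ Φ} z̄_v/|z_v|`»). -/
theorem inv_liuArg (z : ℂ) (hz : z ≠ 0) : (liuArg z)⁻¹ = (starRingEnd ℂ) z / ((‖z‖ : ℝ) : ℂ) := by
  have hn : ((‖z‖ : ℝ) : ℂ) ≠ 0 := by exact_mod_cast norm_ne_zero_iff.mpr hz
  rw [liuArg_eq_div_norm, inv_div, div_eq_div_iff hz hn]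
  have : ((‖z‖ : ℝ) : ℂ) * ((‖z‖ : ℝ) : ℂ) = (starRingEnd ℂ) z * z := by
    rw [mul_comm ((starRingEnd ℂ) z), Complex.mul_conj, Complex.normSq_eq_norm_sq]
    push_cast
    ring
  exact this

/-- `|z|_E^{-1/2} = 1/|z|`. -/
theorem sqrt_complexPlaceAbs (z : ℂ) : Real.sqrt (complexPlaceAbs z) = ‖z‖ := by
  unfold complexPlaceAbs
  rw [Complex.normSq_eq_norm_sq, Real.sqrt_sq (norm_nonneg z)]

/-- **The normalisation of TIER4 §B3(d.5)**: `arg(z)^{-1} · |z|_E^{-1/2} = 1/z`.  The algebraic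
part `μ^alg = μ |·|_E^{-1/2}` of a weight-one character has, in the coordinate of the
embedding `τ'' ∈ Φ_μ`, the archimedean component `z ↦ 1/z` — the component Shimura's
Proposition 19.10 (19.10a) and Liu's p. 140 ll. 34–37 attach to an inclusion-eigenline of
Hodge type `(1,0)`. -/
theorem inv_liuArg_mul_inv_sqrt (z : ℂ) (hz : z ≠ 0) :
    (liuArg z)⁻¹ * (((Real.sqrt (complexPlaceAbs z))⁻¹ : ℝ) : ℂ) = z⁻¹ := by
  rw [inv_liuArg z hz, sqrt_complexPlaceAbs, Complex.inv_def, Complex.normSq_eq_norm_sq]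
  have hn : ((‖z‖ : ℝ) : ℂ) ≠ 0 := by exact_mod_cast norm_ne_zero_iff.mpr hz
  push_cast
  field_simp

/-- **The conjugate coordinate**: if `τ' ∉ Φ_μ`, so that `τ' = \overline{τ''}` with `τ'' ∈ Φ_μ`,
the coordinate of `τ'` is `w = z̄`, and the component `z ↦ 1/z` reads `w ↦ 1/w̄ = \overline{1/w}`
in it — the component attached to an eigenline of Hodge type `(0,1)`. -/
theorem inv_liuArg_mul_inv_sqrt_conj (w : ℂ) (hw : w ≠ 0) :
    (liuArg ((starRingEnd ℂ) w))⁻¹ *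
        (((Real.sqrt (complexPlaceAbs ((starRingEnd ℂ) w)))⁻¹ : ℝ) : ℂ) = (starRingEnd ℂ) w⁻¹ := by
  rw [inv_liuArg_mul_inv_sqrt _ ((map_ne_zero _).mpr hw), map_inv₀]

/-- The two components `1/z` and `1/z̄` differ for every non-real `z` (so the Hodge type of the
inclusion-eigenline is detected by the archimedean component, TIER4 §B3(d.2)). -/
theorem inv_ne_conj_inv {z : ℂ} (hz : z.im ≠ 0) : z⁻¹ ≠ (starRingEnd ℂ) z⁻¹ := by
  intro h
  rw [map_inv₀] at h
  have hzz : z = (starRingEnd ℂ) z := by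
    have := congrArg (fun x : ℂ => x⁻¹) h
    simpa using this
  have him : z.im = -z.im := by
    have := congrArg Complex.im hzz
    simpa using this
  apply hz
  linarith

end Arg

section Tetrahedra

variable {K : Type*} [Field K]

/-- The even tetrahedron `{000, 011, 101, 110}` of the CM type `τ`, as four CM types of `K`
(the conjugate of `parityTetrahedron K τ`). -/
def evenTetrahedron (τ : Fin 3 → K →+* ℂ) : Fin 4 → Set (K →+* ℂ) :=
  fun i => cubeType τ (evenTetra i)

/-- Conjugating every vertex of the parity tetrahedron gives the even tetrahedron, vertex by
vertex. -/
theorem evenTetrahedron_eq_conjCMType {τ : Fin 3 → K →+* ℂ} (hτ : Function.Injective τ)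
    (hcm : IsCMType K (Set.range τ)) (i : Fin 4) :
    evenTetrahedron τ i = conjCMType K (parityTetrahedron K τ i) := by
  rw [parityTetrahedron_eq_cubeType, conjCMType_cubeType hτ hcm]
  rfl

/-- Conjugating every vertex of the even tetrahedron gives back the parity tetrahedron. -/
theorem parityTetrahedron_eq_conjCMType_evenTetrahedron {τ : Fin 3 → K →+* ℂ}
    (hτ : Function.Injective τ) (hcm : IsCMType K (Set.range τ)) (i : Fin 4) :
    parityTetrahedron K τ i = conjCMType K (evenTetrahedron τ i) := by
  unfold evenTetrahedron
  rw [conjCMType_cubeType hτ hcm, parityTetrahedron_eq_cubeType]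
  have : cubeConj (evenTetra i) = oddTetra i := by
    funext ν
    simp [evenTetra, cubeConj]
  rw [this]

/-- **Complex conjugation exchanges the two parity tetrahedra** (as sets of four CM types). -/
theorem range_conjCMType_parityTetrahedron {τ : Fin 3 → K →+* ℂ} (hτ : Function.Injective τ)
    (hcm : IsCMType K (Set.range τ)) :
    (Set.range fun i => conjCMType K (parityTetrahedron K τ i)) = Set.range (evenTetrahedron τ) := by
  congr 1
  funext i
  rw [evenTetrahedron_eq_conjCMType hτ hcm]

/-- The even tetrahedron is a rank-four face (balanced). -/
theorem isWeilFace_evenTetrahedron {τ : Fin 3 → K →+* ℂ} (hτ : Function.Injective τ)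
    (hcm : IsCMType K (Set.range τ)) : IsWeilFace K (evenTetrahedron τ) := by
  have h := isWeilFace_parityTetrahedron K τ hτ hcm
  refine ⟨fun i => ?_, fun φ => ?_⟩
  · rw [evenTetrahedron_eq_conjCMType hτ hcm]
    exact isCMType_conjCMType K (h.1 i)
  · have := h.2 (NumberField.ComplexEmbedding.conjugate φ)
    rw [← this]
    apply Nat.card_congr
    refine Equiv.subtypeEquivRight fun i => ?_
    rw [evenTetrahedron_eq_conjCMType hτ hcm]
    rfl

variable [NumberField K] [NumberField.IsCMField K] [IsGalois ℚ K]

/-- **The even tetrahedron is inversion-stable too**, for every base embedding `τ₀`: from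
`inverseType_conjCMType` and the landed `range_inverseType_parityTetrahedron`. -/
theorem range_inverseType_evenTetrahedron (h6 : Module.finrank ℚ K = 6) (τ₀ : K →+* ℂ)
    {τ : Fin 3 → K →+* ℂ} (hτ : Function.Injective τ) (hcm : IsCMType K (Set.range τ)) :
    (Set.range fun i => inverseType K τ₀ (evenTetrahedron τ i)) = Set.range (evenTetrahedron τ) := by
  have key := range_inverseType_parityTetrahedron K h6 τ₀ τ hcm
  have e1 : (fun i => inverseType K τ₀ (evenTetrahedron τ i)) =
      fun i => conjCMType K (inverseType K τ₀ (parityTetrahedron K τ i)) := by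
    funext i
    rw [evenTetrahedron_eq_conjCMType hτ hcm, inverseType_conjCMType]
  have e2 : evenTetrahedron τ = fun i => conjCMType K (parityTetrahedron K τ i) := by
    funext i
    exact evenTetrahedron_eq_conjCMType hτ hcm i
  rw [e1, e2, Set.range_comp' (conjCMType K), Set.range_comp' (conjCMType K), key]

/-- The vertex-by-vertex form: `T ↦ T^{-1}` permutes the vertices of the even tetrahedron. -/
theorem exists_inverseType_evenTetrahedron_eq (h6 : Module.finrank ℚ K = 6) (τ₀ : K →+* ℂ)
    {τ : Fin 3 → K →+* ℂ} (hτ : Function.Injective τ) (hcm : IsCMType K (Set.range τ)) (i : Fin 4) :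
    ∃ j, inverseType K τ₀ (evenTetrahedron τ i) = evenTetrahedron τ j := by
  have h := range_inverseType_evenTetrahedron h6 τ₀ hτ hcm
  have : inverseType K τ₀ (evenTetrahedron τ i) ∈ Set.range (evenTetrahedron τ) := by
    rw [← h]
    exact ⟨i, rfl⟩
  obtain ⟨j, hj⟩ := this
  exact ⟨j, hj.symm⟩

/-- The vertex-by-vertex form for the parity tetrahedron (from the landed range statement). -/
theorem exists_inverseType_parityTetrahedron_eq (h6 : Module.finrank ℚ K = 6) (τ₀ : K →+* ℂ)
    (τ : Fin 3 → K →+* ℂ) (hcm : IsCMType K (Set.range τ)) (i : Fin 4) :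
    ∃ j, inverseType K τ₀ (parityTetrahedron K τ i) = parityTetrahedron K τ j := by
  have h := range_inverseType_parityTetrahedron K h6 τ₀ τ hcm
  have : inverseType K τ₀ (parityTetrahedron K τ i) ∈ Set.range (parityTetrahedron K τ) := by
    rw [← h]
    exact ⟨i, rfl⟩
  obtain ⟨j, hj⟩ := this
  exact ⟨j, hj.symm⟩

end Tetrahedra

end Summit.Ventures.HodgeRepro2
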